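import Literature.Geometry.Riemannian.GeodesicFlowSmooth
import Literature.Geometry.Riemannian.ExponentialMapSmooth
import Literature.Geometry.Lorentzian.LeviCivitaProofs
import HarnessLib

/-!
# Global smoothness of the exponential map (Lee 2018, Prop. 5.19 (a)) — layer 2 of Thm. 10.34

Consequences of the smooth geodesic flow on `TM` (`GeodesicFlowSmooth.lean`) for the exponential
map of `ExponentialMap.lean`, towards `Literature.Geometry.Riemannian.lee_expMap_injectivityDomain`
(Lee 2018, Thm. 10.34 (c): `exp_p` is smooth on `ID(p)`). Complements the LOCAL smoothness of
`exp` near the zero section of `ExponentialMapSmooth.lean` (`exists_isOpen_contMDiffOn_expMap`,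
`contMDiffAt_expMap_zero`, `mfderiv_expMap_zero`, there) by the GLOBAL statements on the whole
domain `𝓔`:

* `isOpen_setOf_one_mem_maximalGeodesicDomain`, `contMDiffOn_expMap_totalSpace` — the domain
  `𝓔 = {(x, v) ∈ TM | 1 ∈ dom γ_v}` of `exp` is open and `exp : 𝓔 → M` is `C^k` for a `C^k`
  connection (Lee 2018, Prop. 5.19 (a): "`𝓔` is an open subset of `TM` … and `exp` is smooth");
* `isOpen_expDomain`, `contMDiffOn_expMap` — `𝓔_x` is open in `T_x M` and `exp_x` is `C^k` on it
  (Prop. 5.19 (a),(b)); on a geodesically complete connection `exp_x` is `C^k` on `T_x M`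
  (`contMDiff_expMap_of_isGeodesicallyComplete`);
* `contMDiff_riemannianExpMap` — for a smooth (`∞ ≤ n`) pseudo-Riemannian metric with complete
  Levi-Civita connection, `exp_p : T_pM → M` is `C^∞` (the Levi-Civita connection of a `C^n`
  metric is `C^k` for `k + 1 ≤ n`, `isLocallyContMDiff_leviCivita_holds`); in particular the
  smoothness clause of Thm. 10.34 (c) (`contMDiffOn_riemannianExpMap_injectivityDomain`).

No definitions, no named facts (D-0026).

## References

* J. M. Lee, *Introduction to Riemannian Manifolds*, 2nd ed. (2018), Prop. 5.19, Thm. 10.34.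
  [LeeRiemannianManifolds2018]
-/

noncomputable section

open Bundle Set Filter
open scoped Manifold ContDiff Topology

namespace Literature.Geometry.Riemannian

open Literature.Geometry.Lorentzian

section Connection

variable {E : Type*} [NormedAddCommGroup E] [NormedSpace ℝ E] {H : Type*} [TopologicalSpace H]
  {I : ModelWithCorners ℝ E H} {M : Type*} [TopologicalSpace M] [ChartedSpace H M]
  [IsManifold I ∞ M] [FiniteDimensional ℝ E]
  {cov : CovariantDerivative I E (TangentSpace I : M → Type _)}

variable [CompleteSpace E] [T2Space M] [BoundarylessManifold I M] {k : ℕ∞}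
  [CovariantDerivative.ContMDiffCovariantDerivative cov k]
  [CovariantDerivative.ContMDiffCovariantDerivative cov 1]

/-- **The domain `𝓔 = {p ∈ TM | 1 ∈ dom γ_p}` of `exp` is open** (Lee 2018, Prop. 5.19 (a)):
if `1 ∈ dom γ_{p₀}` then `[0, 1] ⊆ dom γ_{p₀}` (an interval), and by
`exists_nhds_contMDiffOn_geodesicFlow_of_subset` the same holds near `p₀`.
[cite: LeeRiemannianManifolds2018, Prop. 5.19 (a)] -/
theorem isOpen_setOf_one_mem_maximalGeodesicDomain (hk : 1 ≤ k) :
    IsOpen {p : TangentBundle I M | (1 : ℝ) ∈ maximalGeodesicDomain cov p.proj p.2} := by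
  rw [isOpen_iff_mem_nhds]
  intro p₀ hp₀
  obtain ⟨hmax, h0, -, -⟩ := maximalGeodesic_spec' (cov := cov) p₀.proj p₀.2
  have hI : Icc (0 : ℝ) 1 ⊆ maximalGeodesicDomain cov p₀.proj p₀.2 := hmax.2.1.out h0 hp₀
  obtain ⟨𝒱, h𝒱o, hp𝒱, hdom, -⟩ :=
    exists_nhds_contMDiffOn_geodesicFlow_of_subset (cov := cov) hk p₀ zero_le_one hI
  exact mem_of_superset (h𝒱o.mem_nhds hp𝒱) fun p hp ↦ hdom p hp ⟨zero_le_one, le_rfl⟩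

/-- **`exp` is `C^k` on `𝓔 ⊆ TM`** for a `C^k` connection (Lee 2018, Prop. 5.19 (a): "`exp` is
smooth", there for smooth connections via the fundamental theorem on flows):
`exp(p) = π(γ_p(1), γ_p'(1))`, the time-one map of the geodesic flow being `C^k` near every point
of `𝓔` (`exists_nhds_contMDiffOn_geodesicFlow_of_subset`) and `π` smooth.
[cite: LeeRiemannianManifolds2018, Prop. 5.19 (a)] -/
theorem contMDiffOn_expMap_totalSpace (hk : 1 ≤ k) :
    ContMDiffOn I.tangent I k (fun p : TangentBundle I M ↦ expMap cov p.proj p.2)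
      {p : TangentBundle I M | (1 : ℝ) ∈ maximalGeodesicDomain cov p.proj p.2} := by
  intro p₀ hp₀
  obtain ⟨hmax, h0, -, -⟩ := maximalGeodesic_spec' (cov := cov) p₀.proj p₀.2
  have hI : Icc (0 : ℝ) 1 ⊆ maximalGeodesicDomain cov p₀.proj p₀.2 := hmax.2.1.out h0 hp₀
  obtain ⟨𝒱, h𝒱o, hp𝒱, hdom, hsm⟩ :=
    exists_nhds_contMDiffOn_geodesicFlow_of_subset (cov := cov) hk p₀ zero_le_one hI
  have h1 : ContMDiffOn I.tangent I k
      (fun p : TangentBundle I M ↦ (tangentLift I (maximalGeodesic cov p.proj p.2) 1).proj) 𝒱 :=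
    (Bundle.contMDiff_proj (TangentSpace I : M → Type _)).comp_contMDiffOn hsm
  have h2 : ContMDiffOn I.tangent I k (fun p : TangentBundle I M ↦ expMap cov p.proj p.2) 𝒱 := by
    refine h1.congr fun p hp ↦ ?_
    rw [expMap_of_mem ⟨hasMaximalGeodesic (cov := cov) p.proj p.2,
      hdom p hp ⟨zero_le_one, le_rfl⟩⟩]
    rfl
  exact (h2.contMDiffAt (h𝒱o.mem_nhds hp𝒱)).contMDiffWithinAt

/-- **`𝓔_x` is open in `T_x M`** (Lee 2018, Prop. 5.19 (a),(b): `𝓔_p` is star-shaped open).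
[cite: LeeRiemannianManifolds2018, Prop. 5.19 (a)] -/
theorem isOpen_expDomain (hk : 1 ≤ k) (x : M) : IsOpen (expDomain cov x) := by
  have h : expDomain cov x = (fun v : E ↦ (⟨x, v⟩ : TangentBundle I M)) ⁻¹'
      {p : TangentBundle I M | (1 : ℝ) ∈ maximalGeodesicDomain cov p.proj p.2} := by
    ext v
    exact ⟨fun hv ↦ hv.2, fun hv ↦ ⟨hasMaximalGeodesic (cov := cov) x v, hv⟩⟩
  rw [h]
  exact (isOpen_setOf_one_mem_maximalGeodesicDomain (cov := cov) hk).preimage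
    (contMDiff_tangentTotalSpaceMk (I := I) (M := M) x).continuous

/-- **`exp_x` is `C^k` on `𝓔_x`** for a `C^k` connection, `1 ≤ k ≤ ∞` (Lee 2018, Prop. 5.19 (a)
restricted to a fibre: `exp_x = exp ∘ (v ↦ (x, v))`; `T_x M` read as the model space `E`).
[cite: LeeRiemannianManifolds2018, Prop. 5.19 (a)] -/
theorem contMDiffOn_expMap (hk : 1 ≤ k) (x : M) :
    ContMDiffOn 𝓘(ℝ, E) I k (fun v : E ↦ expMap cov x (show TangentSpace I x from v))
      {v : E | (show TangentSpace I x from v) ∈ expDomain cov x} :=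
  (contMDiffOn_expMap_totalSpace (cov := cov) hk).comp
    ((contMDiff_tangentTotalSpaceMk (I := I) (M := M) x).of_le (by exact_mod_cast le_top)).contMDiffOn
    (fun _ hv ↦ hv.2)

/-- **On a geodesically complete `C^k` connection `exp_x : T_x M → M` is `C^k`**
(`𝓔_x = T_x M`, `expDomain_eq_univ`). [cite: LeeRiemannianManifolds2018, Prop. 5.19 (a) and p. 131] -/
theorem contMDiff_expMap_of_isGeodesicallyComplete (hk : 1 ≤ k) (hc : IsGeodesicallyComplete cov)
    (x : M) : ContMDiff 𝓘(ℝ, E) I k (fun v : E ↦ expMap cov x (show TangentSpace I x from v)) := by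
  have h := contMDiffOn_expMap (cov := cov) hk x
  have hu : {v : E | (show TangentSpace I x from v) ∈ expDomain cov x} = univ :=
    eq_univ_of_forall fun v ↦ by
      show (show TangentSpace I x from v) ∈ expDomain cov x
      rw [expDomain_eq_univ (cov := cov) hc x]
      exact mem_univ _
  rw [hu] at h
  exact contMDiffOn_univ.1 h

end Connection

/-! ### The Riemannian exponential map of a smooth metric -/

section Riemannian

open Literature.Geometry.Lorentzian.PseudoRiemannianMetric

variable {E : Type*} [NormedAddCommGroup E] [NormedSpace ℝ E] {H : Type*} [TopologicalSpace H]
  {I : ModelWithCorners ℝ E H} {M : Type*} [TopologicalSpace M] [ChartedSpace H M]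
  [IsManifold I ∞ M] {n : ℕ∞ω} [FiniteDimensional ℝ E] [CompleteSpace E] [T2Space M]
  [BoundarylessManifold I M]
  (g : PseudoRiemannianMetric I n E (TangentSpace I : M → Type _)) [g.HasLeviCivita]
  [CovariantDerivative.ContMDiffCovariantDerivative g.leviCivita 1]

omit [T2Space M] [BoundarylessManifold I M]
  [CovariantDerivative.ContMDiffCovariantDerivative g.leviCivita 1] in
/-- The Levi-Civita connection of a smooth (`∞ ≤ n`) metric is `C^∞`
(`isLocallyContMDiff_leviCivita_holds`, Gallot–Hulin–Lafontaine 2004, Prop. 2.54).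
[cite: GallotHulinLafontaine2004, Prop. 2.54] -/
theorem contMDiffCovariantDerivative_leviCivita_infty (hn : (∞ : ℕ∞ω) ≤ n) :
    CovariantDerivative.ContMDiffCovariantDerivative g.leviCivita ((⊤ : ℕ∞) : ℕ∞ω) := by
  haveI : Fact (1 ≤ n) := ⟨le_trans (by exact_mod_cast le_top) hn⟩
  have hk : ((⊤ : ℕ∞) : ℕ∞ω) + 1 ≤ n := le_trans (by exact_mod_cast le_rfl) hn
  exact ⟨g.isLocallyContMDiff_leviCivita_holds ⊤ hk univ isOpen_univ⟩

/-- **`exp_p : T_pM → M` is `C^∞` for a smooth metric with complete Levi-Civita connection**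
(Lee 2018, Prop. 5.19 (a) with p. 131). [cite: LeeRiemannianManifolds2018, Prop. 5.19 (a)] -/
theorem contMDiff_riemannianExpMap (hn : (∞ : ℕ∞ω) ≤ n)
    (hc : IsGeodesicallyComplete g.leviCivita) (p : M) :
    ContMDiff 𝓘(ℝ, E) I ∞ (fun w : E ↦ riemannianExpMap g p (show TangentSpace I p from w)) := by
  haveI := contMDiffCovariantDerivative_leviCivita_infty g hn
  have h := contMDiff_expMap_of_isGeodesicallyComplete (cov := g.leviCivita) (k := (⊤ : ℕ∞))
    le_top hc p
  exact h

/-- **The smoothness clause of Lee 2018, Thm. 10.34 (c)**: `exp_p` is `C^∞` on the injectivity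
domain `ID(p)` (indeed on all of `T_pM`, `contMDiff_riemannianExpMap`).
[cite: LeeRiemannianManifolds2018, Thm. 10.34 (c)] -/
theorem contMDiffOn_riemannianExpMap_injectivityDomain (hn : (∞ : ℕ∞ω) ≤ n)
    (hg : g.IsRiemannian) (hc : IsGeodesicallyComplete g.leviCivita) (p : M) :
    ContMDiffOn 𝓘(ℝ, E) I ∞ (fun w : E ↦ riemannianExpMap g p (show TangentSpace I p from w))
      {w : E | (show TangentSpace I p from w) ∈ injectivityDomain g hg p} :=
  (contMDiff_riemannianExpMap g hn hc p).contMDiffOn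

end Riemannian

end Literature.Geometry.Riemannian
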